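import Literature.IUT.HodgeArakelov.BadPrimeGaussianMonoidsProofs4
import Literature.IUT.HodgeArakelov.BadPrimeGaussianMonoidsSyncProofs
import Literature.IUT.HodgeArakelov.TemperedThetaMonoidsProofs3

/-!
# [IUTchII] Cor 3.5 (ii)/(iii): the restriction ISOMORPHISM `Ψ^ι_env ⥲ Ψ_ξ` from Kummer data + theta evaluation —
# GENERIC form (Kummer map `κ : M₀ →* E.H` of ANY monoid of constants, no [AbsTopIII] `AbsTopMonoids` interface),
# instantiable at the genuine record (`κ := h1LimKummerOn 𝒪^▷`); proof-only twin of `…RestrictionIsoKummerProofs.lean`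

S. Mochizuki, *Inter-universal Teichmüller theory II*, kurims Dec-2020 manuscript: Cor 3.5 (i) p. 94 ("by restricting
the monoid `Ψ_cns(M^Θ_*)` … one obtains … `Ψ_cns(M^Θ_*) ⥲ Ψ_cns(M^Θ_*)_{⟨|F_l|⟩}` … an isomorphism of monoids"),
(ii) p. 95 ("`Ψ^ι_env(M^Θ_*) ⥲ Ψ_ξ(M^Θ_*)` … isomorphisms of monoids"), (iii) p. 95 ("splitting up to torsion …
`Ψ_ξ = Ψ^×_cns,⟨F_l^⋇⟩ · ξ^ℕ`"), Cor 2.8 (i) p. 82 (restriction to `D^δ_{t,μ_-}` "yields … `θ^t_env`", the Kummer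
classes of the theta VALUES), Prop 3.1 (ii) p. 88 (`Ψ_cns := M_TM`, Kummer map of [AbsTopIII] Prop 3.2), Rmk 2.5.1
(i) p. 72 (the theta values `q_v^{j²}`, non-units for `j ≠ 0`) [cite: Mochizuki2012, Cor 3.5 (ii) p.95]. Claim key DISPUTED
(D-0012). PROOF-ONLY companion (abc-iut cell, layer L6, seat abc-iut-w4-d004 gen 2; node **IUTchII:Cor3.5(ii)**,
restriction-ISO clause, sub-DAG row Cor-35.ii.r12; (iii) row Cor-35.iii.r14). NO definition, NO `Prop` fact.
GENERIC TWIN of `BadPrimeGaussianMonoidsRestrictionIsoKummerProofs.lean` (which is stated over abc-iut-L6-t1's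
`AbsTopMonoids`): here the constant monoid is ANY commutative monoid `M₀` with an injective Kummer map `κ : M₀ →* E.H`,
`Ψ_cns = κ(M₀)` (abc-iut-w4-d007's generic `kummer_mem_units_iff` / `units_coe_eq_image_isUnit` replace
`mem_units_iff_of_kummer`), so that the clause can be instantiated at the genuine record with `κ := h1LimKummerOn 𝒪^▷`.

abc-iut-w4-d004's `exists_unique_restrictionIso'_thetaMonoid` (Proofs4, the typing of record after RQ7 d017-F1-1)
produces the UNIQUE isomorphism `Ψ^ι_env ⥲ Ψ_ξ` pinned to the restriction from the junction hypotheses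
`horb` (`θ^ι_env` one `M^×_TM`-orbit — derived at the produced record in `…RecordOrbitProofs`), `hU`/`hUsurj`
(restriction carries `M^×_TM` label-independently ONTO the units of the labeled copy) and `hinj` (injectivity at one
label). THIS FILE derives `hU`, `hUsurj`, `hinj` for restriction morphisms `R_t : Ψ^ι_env → M` (into any ambient
commutative monoid `M`, e.g. the `G_v`-level cohomology `lim_{J_G} H¹(G_v|_{J_G}, Π_μ)`) from THREE printed inputs,
all DATA/identities of the Kummer/evaluation layer and NOT junction hypotheses of Cor 3.5:
* (K) the Kummer map `κ : M_TM(Π_X(M^Θ_*)) → lim_J H¹` of Prop 3.1 (ii) with `Ψ_cns = κ(M_TM)`, injective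
  (GAP-LEDGER G-w4d019-1, as in every file of the family), and the `G_v`-LEVEL Kummer map `κ₀ : M_TM → M`, injective
  ([AbsTopIII] Prop 3.2 (ii) / Kummer theory of MLFs; at the model abc-iut-w4-d007 `kummerHom_injective`);
* (R) restriction of constants: `R_t (κ m) = κ₀ m` for every label — "by restricting the monoid `Ψ_cns(M^Θ_*)` …
  via `Π_{v▶} ↠ G_v`" (Cor 3.5 (i)): the constants are pulled back from `G_v`, so restricting them to a section
  `D_{t,μ_-} ≅ G_v` returns the `G_v`-level class, independently of `t`;
* (E) theta evaluation: `R_t θ = κ₀ (q_t)` for constants `q_t ∈ M_TM` (Cor 2.8 (i): the restricted classes `θ^t_env`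
  are Kummer classes of the theta values), with, at ONE label `t₀`, UNIQUE FACTORISATION `M_TM^× × q_{t₀}^ℕ`
  (`q_{t₀}` of positive valuation in `O^▷ ≅ O^× × ℕ`, Rmk 2.5.1 (i): `q_v^{j²}`, `j ≠ 0`).
Results: `exists_eq_kummer_mul_theta_pow` (`Ψ^ι_env = κ(M_TM^×) · θ^ℕ` elementwise), `restriction_eq`,
`restriction_mem_mrange` (every restricted value lies in the labeled copy `κ₀(M_TM) ⊆ M` of the constant monoid),
`restriction_units_diagonal` (= `hU`), `restriction_units_surjective` (= `hUsurj`), `restriction_injective` (= `hinj`),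
and `exists_unique_restrictionIso'_ofKummer` — **the restriction isomorphism `Ψ^ι_env ⥲ Ψ_ξ ⊆ ∏_t κ₀(M_TM)` of
Cor 3.5 (ii), UNIQUE, from (K), (R), (E) and `horb` only.** Nothing here asserts a disputed claim or takes a side on
[IUTchIII] Cor 3.12; typed ≠ proved ≠ endorsed.
-/

namespace Literature.IUT.HodgeArakelov

namespace BadPrimeGaussianMonoids

open TemperedThetaMonoids

universe u v w

section KummerJunction

variable {Q : Type u} [Group Q] (E : TemperedThetaMonoids.ThetaEnvData.{u, v} Q) {M₀ : Type*} [CommMonoid M₀]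
  (κ : M₀ →* E.H) {T : Type*} {M : Type w} [CommMonoid M] (κ₀ : M₀ →* M) {ι : E.Iota} {θ : E.H}

/-- `M^×_TM = κ(M₀^×)` elementwise (abc-iut-w4-d007's generic `units_coe_eq_image_isUnit`): a unit of the record is the
Kummer class of a unit of the constant monoid. [cite: Mochizuki2012, Prop 3.1 (ii) p.88] -/
theorem exists_unit_eq_of_mem_units (hκ : Function.Injective κ) (hcns : E.constantMonoid = MonoidHom.mrange κ)
    (u : E.H) (hu : u ∈ E.units) : ∃ m : (M₀)ˣ, κ (m : M₀) = u := by
  have h := units_coe_eq_image_isUnit E κ hκ hcns.symm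
  have hu' : u ∈ (E.units : Set E.H) := hu
  rw [h] at hu'
  obtain ⟨x, hx, rfl⟩ := hu'
  obtain ⟨m, rfl⟩ := hx
  exact ⟨m, rfl⟩

/-- Conversely the Kummer class of a unit of `M₀` is a unit of the record. [cite: Mochizuki2012, Prop 3.1 (ii) p.88] -/
theorem kummer_unit_mem_units (hκ : Function.Injective κ) (hcns : E.constantMonoid = MonoidHom.mrange κ)
    (m : (M₀)ˣ) : κ (m : M₀) ∈ E.units :=
  (kummer_mem_units_iff E κ hκ hcns.symm (m : M₀)).mpr m.isUnit

/-- `Ψ^ι_env(M^Θ_*) = M^×_TM · θ^ℕ` elementwise, with the units written as Kummer classes of units of `M_TM`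
(Prop 3.1 (i)/(ii); abc-iut-w4-d004 `thetaMonoid_eq_splitMonoid_powers` + abc-iut-w4-d007 `units_coe_eq_image_isUnit`).
[cite: Mochizuki2012, Prop 3.1 (i) p.87] -/
theorem exists_eq_kummer_mul_theta_pow_gen (hκ : Function.Injective κ)
    (hcns : E.constantMonoid = MonoidHom.mrange κ) (hθ : θ ∈ E.thetaEnv ι)
    (horb : ∀ θ' ∈ E.thetaEnv ι, ∃ u ∈ E.units, θ' = u * θ) (x : E.thetaMonoid ι) :
    ∃ (m : (M₀)ˣ) (n : ℕ), (x : E.H) = κ (m : M₀) * θ ^ n := by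
  have hx : (x : E.H) ∈ splitMonoid E.units (Submonoid.powers θ) := by
    rw [← thetaMonoid_eq_splitMonoid_powers E hθ horb]
    exact x.2
  obtain ⟨u, hu, _, ⟨n, rfl⟩, hux⟩ := (mem_splitMonoid_iff _ _ _).mp hx
  obtain ⟨m, rfl⟩ := exists_unit_eq_of_mem_units E κ hκ hcns u hu
  exact ⟨m, n, hux.symm⟩

/-- Kummer classes of units of `M_TM` lie in `Ψ^ι_env` (`M^×_TM ⊆ Ψ^ι_env`). [cite: Mochizuki2012, Prop 3.1 (i) p.87] -/
theorem kummer_unit_mem_thetaMonoid_gen (hκ : Function.Injective κ) (hcns : E.constantMonoid = MonoidHom.mrange κ)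
    (m : (M₀)ˣ) : κ (m : M₀) ∈ E.thetaMonoid ι :=
  units_le_thetaMonoid E ι (kummer_unit_mem_units E κ hκ hcns m)

variable (R : T → (E.thetaMonoid ι →* M)) (q : T → M₀)

/-- The restriction of `κ(m) · θ^n` is `κ₀(m · q_t^n)`: (R) restriction of constants + (E) theta evaluation.
[cite: Mochizuki2012, Cor 3.5 (ii) p.95] -/
theorem restriction_eq_gen (hθ : θ ∈ E.thetaEnv ι)
    (hRκ : ∀ (t : T) (m : M₀) (hm : κ m ∈ E.thetaMonoid ι), R t ⟨κ m, hm⟩ = κ₀ m)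
    (hRθ : ∀ t, R t ⟨θ, thetaEnv_subset_thetaMonoid E ι hθ⟩ = κ₀ (q t)) (t : T) (x : E.thetaMonoid ι)
    (m : (M₀)ˣ) (n : ℕ) (hm : κ (m : M₀) ∈ E.thetaMonoid ι)
    (hx : (x : E.H) = κ (m : M₀) * θ ^ n) : R t x = κ₀ ((m : M₀) * q t ^ n) := by
  have hx' : x = ⟨κ (m : M₀), hm⟩ * ⟨θ, thetaEnv_subset_thetaMonoid E ι hθ⟩ ^ n :=
    Subtype.ext (by rw [hx]; rfl)
  rw [hx', map_mul, map_pow, hRκ, hRθ, ← map_pow, ← map_mul]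

/-- Every restricted value lies in the labeled copy `κ₀(M_TM) ⊆ M` of the constant monoid (`Ψ_cns(M^Θ_*)_{|t|}`).
[cite: Mochizuki2012, Cor 3.5 (i) p.94] -/
theorem restriction_mem_mrange_gen (hκ : Function.Injective κ) (hcns : E.constantMonoid = MonoidHom.mrange κ)
    (hθ : θ ∈ E.thetaEnv ι) (horb : ∀ θ' ∈ E.thetaEnv ι, ∃ u ∈ E.units, θ' = u * θ)
    (hRκ : ∀ (t : T) (m : M₀) (hm : κ m ∈ E.thetaMonoid ι), R t ⟨κ m, hm⟩ = κ₀ m)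
    (hRθ : ∀ t, R t ⟨θ, thetaEnv_subset_thetaMonoid E ι hθ⟩ = κ₀ (q t)) (t : T) (x : E.thetaMonoid ι) :
    R t x ∈ MonoidHom.mrange κ₀ := by
  obtain ⟨m, n, hx⟩ := exists_eq_kummer_mul_theta_pow_gen E κ hκ hcns hθ horb x
  exact ⟨_, (restriction_eq_gen E κ κ₀ R q hθ hRκ hRθ t x m n
    (kummer_unit_mem_thetaMonoid_gen E κ hκ hcns m) hx).symm⟩

/-- **`hU`**: restriction carries each unit `κ(m) ∈ M^×_TM` to the SAME unit `κ₀(m)` of the labeled copy at every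
label (label-independence of the restricted constants, Cor 3.5 (i) "independent of `|t|`").
[cite: Mochizuki2012, Cor 3.5 (i) p.94] -/
theorem restriction_units_diagonal_gen (hκ : Function.Injective κ) (hcns : E.constantMonoid = MonoidHom.mrange κ)
    (hθ : θ ∈ E.thetaEnv ι) (horb : ∀ θ' ∈ E.thetaEnv ι, ∃ u ∈ E.units, θ' = u * θ)
    (hRκ : ∀ (t : T) (m : M₀) (hm : κ m ∈ E.thetaMonoid ι), R t ⟨κ m, hm⟩ = κ₀ m)
    (hRθ : ∀ t, R t ⟨θ, thetaEnv_subset_thetaMonoid E ι hθ⟩ = κ₀ (q t)) (u : E.H) (hu : u ∈ E.units) :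
    ∃ m' : (MonoidHom.mrange κ₀)ˣ, ∀ t,
      (R t).codRestrict (MonoidHom.mrange κ₀)
          (restriction_mem_mrange_gen E κ κ₀ R q hκ hcns hθ horb hRκ hRθ t) ⟨u, units_le_thetaMonoid E ι hu⟩ =
        (m' : MonoidHom.mrange κ₀) := by
  obtain ⟨m, rfl⟩ := exists_unit_eq_of_mem_units E κ hκ hcns u hu
  refine ⟨Units.map (κ₀.mrangeRestrict : M₀ →* MonoidHom.mrange κ₀) m, fun t => Subtype.ext ?_⟩
  rw [MonoidHom.codRestrict_apply, Units.coe_map, MonoidHom.coe_mrangeRestrict]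
  exact hRκ t m _

/-- **`hUsurj`**: every unit of the labeled copy `κ₀(M_TM)` is the restriction of a unit of `M^×_TM` (the same at
every label) — from the injectivity of `κ₀`. [cite: Mochizuki2012, Cor 3.5 (i) p.94] -/
theorem restriction_units_surjective_gen (hκ : Function.Injective κ) (hcns : E.constantMonoid = MonoidHom.mrange κ)
    (hθ : θ ∈ E.thetaEnv ι) (horb : ∀ θ' ∈ E.thetaEnv ι, ∃ u ∈ E.units, θ' = u * θ)
    (hRκ : ∀ (t : T) (m : M₀) (hm : κ m ∈ E.thetaMonoid ι), R t ⟨κ m, hm⟩ = κ₀ m)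
    (hRθ : ∀ t, R t ⟨θ, thetaEnv_subset_thetaMonoid E ι hθ⟩ = κ₀ (q t)) (hκ₀ : Function.Injective κ₀)
    (m' : (MonoidHom.mrange κ₀)ˣ) :
    ∃ (u : E.H) (hu : u ∈ E.units), ∀ t,
      (R t).codRestrict (MonoidHom.mrange κ₀)
          (restriction_mem_mrange_gen E κ κ₀ R q hκ hcns hθ horb hRκ hRθ t) ⟨u, units_le_thetaMonoid E ι hu⟩ =
        (m' : MonoidHom.mrange κ₀) := by
  let e₀ : M₀ ≃* MonoidHom.mrange κ₀ :=
    MulEquiv.ofBijective κ₀.mrangeRestrict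
      ⟨fun a b hab => hκ₀ (by simpa [MonoidHom.coe_mrangeRestrict] using congrArg Subtype.val hab),
        κ₀.mrangeRestrict_surjective⟩
  let mu : (M₀)ˣ := Units.map (e₀.symm : MonoidHom.mrange κ₀ →* M₀) m'
  refine ⟨κ (mu : M₀), kummer_unit_mem_units E κ hκ hcns mu, fun t => ?_⟩
  have h1 : (R t).codRestrict (MonoidHom.mrange κ₀)
      (restriction_mem_mrange_gen E κ κ₀ R q hκ hcns hθ horb hRκ hRθ t)
        ⟨κ (mu : M₀), units_le_thetaMonoid E ι (kummer_unit_mem_units E κ hκ hcns mu)⟩ = e₀ (mu : M₀) := by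
    apply Subtype.ext
    rw [MonoidHom.codRestrict_apply, MulEquiv.ofBijective_apply, MonoidHom.coe_mrangeRestrict]
    exact hRκ t _ _
  rw [h1]
  change e₀ ((e₀.symm : MonoidHom.mrange κ₀ →* M₀) (m' : MonoidHom.mrange κ₀)) = _
  exact e₀.apply_symm_apply _

/-- **`hinj`**: the restriction at a label `t₀` whose theta value `q_{t₀}` admits UNIQUE FACTORISATION
`M_TM^× × q_{t₀}^ℕ` (positive valuation: `q^{j²}`, `j ≠ 0`) is injective on `Ψ^ι_env` — from the injectivity of
the `G_v`-level Kummer map `κ₀`. [cite: Mochizuki2012, Cor 3.5 (ii) p.95] -/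
theorem restriction_injective_gen (hκ : Function.Injective κ) (hcns : E.constantMonoid = MonoidHom.mrange κ)
    (hθ : θ ∈ E.thetaEnv ι) (horb : ∀ θ' ∈ E.thetaEnv ι, ∃ u ∈ E.units, θ' = u * θ)
    (hRκ : ∀ (t : T) (m : M₀) (hm : κ m ∈ E.thetaMonoid ι), R t ⟨κ m, hm⟩ = κ₀ m)
    (hRθ : ∀ t, R t ⟨θ, thetaEnv_subset_thetaMonoid E ι hθ⟩ = κ₀ (q t)) (hκ₀ : Function.Injective κ₀) (t₀ : T)
    (hq₀ : ∀ (m m' : (M₀)ˣ) (n n' : ℕ),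
      (m : M₀) * q t₀ ^ n = m' * q t₀ ^ n' → n = n' ∧ m = m') :
    Function.Injective ((R t₀).codRestrict (MonoidHom.mrange κ₀)
      (restriction_mem_mrange_gen E κ κ₀ R q hκ hcns hθ horb hRκ hRθ t₀)) := by
  intro x y hxy
  obtain ⟨m, n, hx⟩ := exists_eq_kummer_mul_theta_pow_gen E κ hκ hcns hθ horb x
  obtain ⟨m', n', hy⟩ := exists_eq_kummer_mul_theta_pow_gen E κ hκ hcns hθ horb y
  have hR : R t₀ x = R t₀ y := congrArg Subtype.val hxy
  rw [restriction_eq_gen E κ κ₀ R q hθ hRκ hRθ t₀ x m n (kummer_unit_mem_thetaMonoid_gen E κ hκ hcns m) hx,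
    restriction_eq_gen E κ κ₀ R q hθ hRκ hRθ t₀ y m' n' (kummer_unit_mem_thetaMonoid_gen E κ hκ hcns m') hy]
    at hR
  obtain ⟨rfl, rfl⟩ := hq₀ m m' n n' (hκ₀ hR)
  exact Subtype.ext (hx.trans hy.symm)

/-- **IUTchII:Cor3.5(ii)** (kurims p.95) "`Ψ^ι_env(M^Θ_*) ⥲ Ψ_ξ(M^Θ_*)` … isomorphisms of monoids", (iii) "splittings up
to torsion compatible with those of Prop 3.1 (i)": **the restriction ISOMORPHISM of record
(`exists_unique_restrictionIso'_thetaMonoid`) onto the Gaussian monoid `Ψ_ξ ⊆ ∏_t κ₀(M_TM)`, `ξ = (κ₀ q_t)_t`, UNIQUE,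
with its junction hypotheses `hU`, `hUsurj`, `hinj` DERIVED** from the Kummer data (K) (`κ`, `κ₀` injective,
`Ψ_cns = κ(M_TM)`), the restriction of constants (R) (`R_t ∘ κ = κ₀`), the theta evaluation (E) (`R_t θ = κ₀ q_t`)
with unique factorisation at one label, and `horb`. [cite: Mochizuki2012, Cor 3.5 (ii) p.95] -/
theorem exists_unique_restrictionIso'_ofKummer_gen (hκ : Function.Injective κ)
    (hcns : E.constantMonoid = MonoidHom.mrange κ) (hθ : θ ∈ E.thetaEnv ι)
    (horb : ∀ θ' ∈ E.thetaEnv ι, ∃ u ∈ E.units, θ' = u * θ)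
    (hRκ : ∀ (t : T) (m : M₀) (hm : κ m ∈ E.thetaMonoid ι), R t ⟨κ m, hm⟩ = κ₀ m)
    (hRθ : ∀ t, R t ⟨θ, thetaEnv_subset_thetaMonoid E ι hθ⟩ = κ₀ (q t)) (hκ₀ : Function.Injective κ₀) (t₀ : T)
    (hq₀ : ∀ (m m' : (M₀)ˣ) (n n' : ℕ),
      (m : M₀) * q t₀ ^ n = m' * q t₀ ^ n' → n = n' ∧ m = m') :
    ∃! e : E.thetaMonoid ι ≃*
        gaussianMonoid (fun t => (R t).codRestrict (MonoidHom.mrange κ₀)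
          (restriction_mem_mrange_gen E κ κ₀ R q hκ hcns hθ horb hRκ hRθ t)
            ⟨θ, thetaEnv_subset_thetaMonoid E ι hθ⟩),
      ∀ x, ((e x : gaussianMonoid _) : T → MonoidHom.mrange κ₀) =
        MonoidHom.pi (fun t => (R t).codRestrict (MonoidHom.mrange κ₀)
          (restriction_mem_mrange_gen E κ κ₀ R q hκ hcns hθ horb hRκ hRθ t)) x :=
  exists_unique_restrictionIso'_thetaMonoid E hθ horb _
    (restriction_units_diagonal_gen E κ κ₀ R q hκ hcns hθ horb hRκ hRθ)
    (restriction_units_surjective_gen E κ κ₀ R q hκ hcns hθ horb hRκ hRθ hκ₀) t₀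
    (restriction_injective_gen E κ κ₀ R q hκ hcns hθ horb hRκ hRθ hκ₀ t₀ hq₀)

/-- The restricted theta value in the labeled copy IS `κ₀ q_t` (the value-profile coordinate `ξ_t`).
[cite: Mochizuki2012, Cor 3.5 (ii) p.94] -/
theorem restriction_theta_coe_gen (hκ : Function.Injective κ) (hcns : E.constantMonoid = MonoidHom.mrange κ)
    (hθ : θ ∈ E.thetaEnv ι) (horb : ∀ θ' ∈ E.thetaEnv ι, ∃ u ∈ E.units, θ' = u * θ)
    (hRκ : ∀ (t : T) (m : M₀) (hm : κ m ∈ E.thetaMonoid ι), R t ⟨κ m, hm⟩ = κ₀ m)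
    (hRθ : ∀ t, R t ⟨θ, thetaEnv_subset_thetaMonoid E ι hθ⟩ = κ₀ (q t)) (t : T) :
    ((R t).codRestrict (MonoidHom.mrange κ₀)
        (restriction_mem_mrange_gen E κ κ₀ R q hκ hcns hθ horb hRκ hRθ t)
          ⟨θ, thetaEnv_subset_thetaMonoid E ι hθ⟩ : M) = κ₀ (q t) := by
  rw [MonoidHom.codRestrict_apply]
  exact hRθ t

end KummerJunction

end BadPrimeGaussianMonoids

end Literature.IUT.HodgeArakelov
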